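import Literature.Barriers.CriticalPhenomena.PlaquetteWalkHoleRootRowLaw
import Literature.Barriers.CriticalPhenomena.PlaquetteWalkHoleRootNoKissSeven
import HarnessLib

/-!
# Barrier catalogue (SAWScalingLimit): THE ROOT-ROW LAW of the printed vertex functional, (R2) DISCHARGED («ROOT-ROW LAW»)

`Z → ∞` limit model of the printed Yang–Baxter weights [GlazmanManolescu2019, §1, eq. (1)]; the «RECTANGLE COEFFICIENT» line of the venture lane
«pcv-sawmu» (b-engine-1 g23–g26). `PlaquetteWalkHoleRootRowLaw.vertexFunctional_printed_zero_set_finite_of_noDoubleVisit` (#971) proved the law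
«`VF_D(w.side W, f₀; ·) ≢ 0` at a root-row rhombus `f₀` carrying a wound member of limit cost `5`» MODULO the structural statement (R2): the wound
class-`B2a` walks at `f₀` of limit cost `5`, and those of limit cost `7` with a vertical end and a turning first arc, visit no plaquette twice. (R2) is now
proved for `f₀` east of the hole on the root row: `PlaquetteWalkHoleRootNoKiss.injective_of_cost_five` and
`PlaquetteWalkHoleRootNoKissSeven.injective_of_cost_seven_vert` (chain calculus). ★★★★★ `vertexFunctional_printed_zero_set_finite_of_rootRow`: for a
`W`-normalised hole root `a = w.side W` of a finite domain `dom Dl` (hole `(w.1 − 1, w.2)` absent) and a rooted rhombus `f₀ = (f₀.1, w.2)` with `w.1 ≤ f₀.1`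
at which SOME wound class-`B2a` walk of limit cost `5` exists, the printed Yang–Baxter vertex functional `VF_D(a, f₀; θ)` vanishes for at most
`4·maxExp − 4` angles `θ ∈ (0, π)` — in particular it is not identically zero: the hole-rooted exception to conjecture C-B2 is generic along the root row.
[GlazmanManolescu2019 §1 Fig. 1, eq. (1), Lemma 2.1, Remark 2.2; Glazman2015WeightedSAW Lemma 3.1 (proof, pp. 6–7)]
-/

noncomputable section

namespace Literature.Barriers.CriticalPhenomena.PlaquetteWalk

open Literature.Probability.RandomPlanarGeometry.SAW.YangBaxter
open Real

variable (Dl : List Face)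

open Classical in
/-- ★★★★★ **THE ROOT-ROW LAW.** Let `a = w.side W` be a `W`-normalised hole root of the finite domain `dom Dl` (hole `(w.1 − 1, w.2)` absent) and `f₀` a rooted
rhombus of the root row east of the hole (`f₀.2 = w.2`, `w.1 ≤ f₀.1`) carrying some WOUND class-`B2a` walk of limit cost `5`. Then the printed Yang–Baxter vertex
functional `θ ↦ VF_D(a, f₀; θ)` has finitely many zeros in `(0, π)`, at most `4·maxExp − 4`; in particular it is not identically zero. ((R2) discharged by
`ΩG.injective_of_cost_five` / `ΩG.injective_of_cost_seven_vert`.) [cite: GlazmanManolescu2019, Lemma 2.1 and eq. (1); Remark 2.2]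
[cite: Glazman2015WeightedSAW, Lemma 3.1 (proof, pp. 6–7)] -/
theorem vertexFunctional_printed_zero_set_finite_of_rootRow {w f₀ : Face} (hh : holeFaceW w ∉ dom Dl)
    (hr : RootedFace (dom Dl) (w.side .W) f₀) (hrow : f₀.2 = w.2) (hcol : w.1 ≤ f₀.1)
    (hex : ∃ (ω : ΩG (dom Dl) (w.side .W) f₀) (h : ω.IsB2a), ω.AJ hr h (toC (midPt (w.side .W))) ≠ 0 ∧
      cost (slotOfSide ω.1) ω.2.mids = 5) :
    {θ ∈ Set.Ioo 0 π | vertexFunctional (printedWeights θ) tFiveEighths (ybCoeff θ) Dl (w.side .W) f₀ = 0}.Finite ∧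
      {θ ∈ Set.Ioo 0 π | vertexFunctional (printedWeights θ) tFiveEighths (ybCoeff θ) Dl (w.side .W) f₀ = 0}.ncard ≤
        4 * maxExp Dl (w.side .W) f₀ + 1 - 5 :=
  vertexFunctional_printed_zero_set_finite_of_noDoubleVisit Dl hh hr hrow (fun ω h hA hc => by
    rcases hc with hc5 | ⟨hc7, hEW, hNS⟩
    · exact ΩG.injective_of_cost_five hh hr h hA hc5 hrow hcol
    · exact ΩG.injective_of_cost_seven_vert hh hr h hA hc7 hEW hNS hrow hcol) hex

/-- ★★★★ **NOT IDENTICALLY ZERO ON THE ROOT ROW**: under the same hypotheses some angle `θ ∈ (0, π)` has `VF_D(a, f₀; θ) ≠ 0`.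
[cite: GlazmanManolescu2019, Lemma 2.1 and eq. (1); Remark 2.2] [cite: Glazman2015WeightedSAW, Lemma 3.1 (proof, pp. 6–7)] -/
theorem vertexFunctional_printed_exists_ne_zero_of_rootRow {w f₀ : Face} (hh : holeFaceW w ∉ dom Dl)
    (hr : RootedFace (dom Dl) (w.side .W) f₀) (hrow : f₀.2 = w.2) (hcol : w.1 ≤ f₀.1)
    (hex : ∃ (ω : ΩG (dom Dl) (w.side .W) f₀) (h : ω.IsB2a), ω.AJ hr h (toC (midPt (w.side .W))) ≠ 0 ∧
      cost (slotOfSide ω.1) ω.2.mids = 5) :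
    ∃ θ ∈ Set.Ioo 0 π, vertexFunctional (printedWeights θ) tFiveEighths (ybCoeff θ) Dl (w.side .W) f₀ ≠ 0 := by
  classical
  obtain ⟨hfin, -⟩ := vertexFunctional_printed_zero_set_finite_of_rootRow Dl hh hr hrow hcol hex
  by_contra hno
  push Not at hno
  have hsub : Set.Ioo (0 : ℝ) π ⊆ {θ ∈ Set.Ioo 0 π | vertexFunctional (printedWeights θ) tFiveEighths (ybCoeff θ) Dl (w.side .W) f₀ = 0} :=
    fun θ hθ => ⟨hθ, hno θ hθ⟩
  exact (Set.Ioo_infinite Real.pi_pos).mono hsub |> fun hinf => hinf (hfin)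

end Literature.Barriers.CriticalPhenomena.PlaquetteWalk
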